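import Mathlib
import Literature.Geometry.Lorentzian.KlainermanSzeftel2021.IterationClosure

/-!
# Klainerman–Szeftel §9.4: the choice (9.2.7) of `u_*'` and the two endpoint displays of §9.4.8, `L_*(k_large+7) ≲ ℜ_{k_large+7} + 𝔖*_{k_large+7}` (l.24709–24725) and `L_*(k_small−1) ≲ ε₀` (l.24684–24687), as real analysis over `Ch9Iteration`

CITATION HEADER (lean-in-tree rule 2026-08-18).  Source: S. Klainerman, J. Szeftel, *Kerr stability for small angular
momentum*, arXiv:2104.11857 (v1, 2021; TeX source `Main-Kerr-arxiv.tex`, lines quoted as `l.N`) = bib key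
`KlainermanSzeftel2021`; journal record Pure Appl. Math. Q. **19** (2023) no. 3, 791–1678 (refereed; not separately read for
v1 of this module — acquisition acq-07685 of the audit cell; READ for v2 in the authors' accepted manuscript HAL hal-04280491, see
JOURNAL CURRENCY below).  The manuscript is UNDER ADJUDICATION by the audit cell: nothing in it is cited here as
a fact; every display of [KS] enters as a HYPOTHESIS of a kernel-checked implication, and the only things PROVED are pieces of
real analysis and arithmetic.

WHAT IS TYPED.  The kernel certificate `Ch9Iteration.thm9410_explicit` of `IterationClosure.lean` (this directory) takes as
inputs the two un-numbered displays of §9.4.8 that the audit cell's registry calls KS9.4.8-L0 and KS9.4.8-L7: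
* L0 (l.24684–24687): "in view of (9.4.22), we have `L_*(k_small−1) ≲ ε₀`";
* L7 (l.24709–24725): "`L²_*(k_large+7) = ∫_{u=u_*'} |Ř|²_{w,k_large+7} + ∫_{Σ_*∩{u=u_*'}} |Γ̌|²_{w,k_large+7}`" (definition
  (9.4.34) of `L_*`, l.24452–24460), "recall from (9.2.7) that [this] `= inf_{u_*−2 ≤ u₁ ≤ u_*−1} ( … )`.  We infer
  `L²_*(k_large+7) ≲ ∫_{u₁=u_*−2}^{u_*−1} ( … ) du₁`.  In view of the definition of `|Ř|_{w,k}` and `|Γ̌|_{w,k}` in (9.4.35), and the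
  definition of `ℜ_k` and `𝔖*_k` in section 9.4.1, we deduce `L_*(k_large+7) ≲ ℜ_{k_large+7} + 𝔖*_{k_large+7}` where the constant
  in `≲` is independent of `r₀`."
NUMBERING NOTE (audit-cell REFEREE.md V7): the display `eq:choicofuprimestarbyLebesguepointarguement` prints as (9.2.7) in [KS] v1 (an earlier revision of this docstring wrote "(9.4.6)", which is a different display, `definit:norms-SkMtop'`, l.23967–23970); the `946` kept in the declaration names `Choice946`, `choice946_of_continuousOn`, `sqrt_le_of_choice946` and in binder names `h946` is that historical misnumbering and refers to (9.2.7).  Likewise the weighted norms recalled at l.24722 are (9.4.35) = `eq:defintionofthenormsRcGacweighted:bis` (l.24456–24461), not (9.4.36).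
Here (9.2.7) (l.23585–23590, §9.2.8 "The choice of the constant `u_*'`", label
`eq:choicofuprimestarbyLebesguepointarguement`) reads: "we choose `u_*'` such that we have
`∫_{u=u_*'} |Ř|²_{w,k_large+7} + ∫_{Σ_*∩{u=u_*'}} |Γ̌|²_{w,k_large+7} = inf_{u_*−2 ≤ u₁ ≤ u_*−1} ( ∫_{u=u₁} … + ∫_{Σ_*∩{u=u₁}} … )`."

The slice functional `F : ℝ → ℝ`, `F(u₁) := ∫_{u=u₁} |Ř|²_{w,k_large+7} + ∫_{Σ_*∩{u=u₁}} |Γ̌|²_{w,k_large+7}`, is an opaque real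
function here.  PROVED (real analysis, `[folklore]`): an attained infimum on `[u_*−2, u_*−1]` exists as soon as `F` is
continuous there (`choice946_of_continuousOn` — a SUFFICIENT condition; [KS]'s label speaks of a "Lebesgue point argument"
while the display asserts an attained infimum); the minimum value is at most the mean over the unit-length interval
(`mul_sub_le_setIntegral_of_isMinOn`, `le_setIntegral_Icc_unit_of_isMinOn` — the step "We infer" of l.24718–24721); hence
`√F(u_*') ≤ √C·(X + Y)` from any slab bound `∫ F ≤ C(X² + Y²)` (`sqrt_le_of_choice946`).  HYPOTHESES (the geometric content,
named): `hslab` = the coarea identity `∫_{u₁} (∫_{u=u₁} …) du₁ = ∫_{slab} …` with the lapse of the `u`-foliation, the pointwise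
comparison of the integrands of (9.4.35) with those of `^{(ext)}ℜ²_k` (a bulk integral over `Mext`, §9.4.1 l.23912–23916) and of
`𝔖*²_k` (an integral over `Σ_*`, l.23871–23880), and the set inclusions slab `⊂ Mext`, `Σ_* ∩ slab ⊂ Σ_*` — i.e. exactly the
clause "in view of the definition[s] … we deduce" of l.24720–24723; `hRext` = `^{(ext)}ℜ_k ≤ ℜ_k` (definition of the global norm
as a sum over regions).  For L0 the input `hdec` is a bound of the SAME slice functional at level `k_small−1` evaluated at the
top-level minimiser `u_*'` — which the global norms of (9.4.22) do not control slice-wise (no minimising choice is available at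
that level; `^{(ext)}ℜ` is a bulk norm); in print it comes from the sup-decay bounds in the PROOF of Lemma 9.4.13
(l.24362–24427), a reading recorded by the audit cell, not asserted here.
`Ch9Iteration.thm9410_from_slices` is `thm9410_explicit` with `hL0`, `hL7` discharged from these inputs (constants
`C₀ := √C₀'`, `C₅ := √C_co`).  Nothing here is Final-State-Conjecture progress: value = typed skeleton.

JOURNAL CURRENCY (v2 of this module, 2026-08-19).  The refereed text was then read in the authors' accepted manuscript, HAL
deposit hal-04280491 (dated July 14, 2023; citation line: Pure Appl. Math. Q. **19** (3) (2023) 791–1678; bib key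
`KlainermanSzeftel2023`), locators `HAL hal-04280491 p. N Lm` = PDF page `N`, text line `m`.  Outcome: (9.2.7) keeps its
number and its shape but its WINDOW CHANGED — `[J]` p. 606 L21–46: "With the notations in (9.2.6), we choose `u_*'` such that
we have `∫_{u=u_*'} |Ř|²_{w,k_large+7} + ∫_{Σ_*∩{u=u_*'}} |Γ̌|²_{w,k_large+7} = inf_{u_*−5 ≤ u₁ ≤ u_*−4} ( ∫_{u=u₁} … +
∫_{Σ_*∩{u=u₁}} … )`" (e-print: `inf_{u_*−2 ≤ u₁ ≤ u_*−1}`), recalled verbatim in §9.4.8 Step 4 (p. 634 L2–26), which then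
reads "We infer `L²_*(k_large+7) ≲ ∫_{u₁=u_*−5}^{u_*−4} ( … ) du₁`.  In view of the definition of `|Ř|_{w,k}` and `|Γ̌|_{w,k}` in
(9.4.37), and the definition of `ℜ_k` and `⋆𝔊_k` in Section 9.4.1, we deduce `L_*(k_large+7) ≲ ℜ_{k_large+7} + ⋆𝔊_{k_large+7}`
where the constant in `≲` is independent of `r₀`" (p. 634 L27–47; `[J]` (9.4.36) = e-print (9.4.34) defines `L_*`, `[J]`
(9.4.37) = e-print (9.4.35) the weighted norms; L0 = "Also, in view of (9.4.23), we have `L_*(k_small−1) ≲ ε0`", p. 633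
L23–24, with `[J]` (9.4.23) = e-print (9.4.22) = Lemma 9.4.13).  The window is still of UNIT LENGTH, which is all the
min-≤-mean step uses.  v2 is ADDITIVE: the e-print declarations above are untouched; the new section `JournalWindow` types
the choice over a GENERAL window `[a, b]` (`ChoiceOn`, with `Choice946` and the journal's `Choice927J` as its two instances,
`choice946_iff_choiceOn` / `choice927J_iff_choiceOn`), proves the unit-window lemmas once (`le_setIntegral_of_choiceOn_unit`,
`sqrt_le_of_choiceOn`) and re-derives the registry node KS9.4.8-L7 and the closing certificate for the journal window
(`Ch9Iteration.L7_of_sliceOn`, `L7_of_sliceJ`, `thm9410_from_slicesJ`).  The importer `SupToFluxExponents` is unaffected.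
-/

namespace Literature.Geometry.Lorentzian.KlainermanSzeftel2021

open MeasureTheory Set

namespace SliceChoice

/-- KS (9.2.7), l.23585–23590: `u'` lies in `[u_* − 2, u_* − 1]` and realises there the infimum of the slice
functional `F(u₁) = ∫_{u=u₁} |Ř|²_{w,k_large+7} + ∫_{Σ_*∩{u=u₁}} |Γ̌|²_{w,k_large+7}` (an attained infimum, as displayed).
[cite: KlainermanSzeftel2021, eq. (9.2.7), TeX l.23585–23590] -/
def Choice946 (F : ℝ → ℝ) (uStar u' : ℝ) : Prop :=
  u' ∈ Icc (uStar - 2) (uStar - 1) ∧ IsMinOn F (Icc (uStar - 2) (uStar - 1)) u'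

/-- A continuous function on the compact interval `[u_* − 2, u_* − 1]` attains its infimum: a sufficient condition for the
choice (9.2.7) to be possible (extreme value theorem). [folklore] -/
theorem choice946_of_continuousOn {F : ℝ → ℝ} {uStar : ℝ}
    (hF : ContinuousOn F (Icc (uStar - 2) (uStar - 1))) : ∃ u', Choice946 F uStar u' := by
  have hne : (Icc (uStar - 2) (uStar - 1)).Nonempty := nonempty_Icc.2 (by linarith)
  obtain ⟨u', hu', hmin⟩ := isCompact_Icc.exists_isMinOn hne hF
  exact ⟨u', hu', hmin⟩

/-- Minimum times length is at most the integral: if `F u' ≤ F t` on `[a, b]` (`a ≤ b`) and `F` is integrable there, then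
`F(u')·(b − a) ≤ ∫_{[a,b]} F`. [folklore] -/
theorem mul_sub_le_setIntegral_of_isMinOn {F : ℝ → ℝ} {a b u' : ℝ} (hab : a ≤ b)
    (hmin : IsMinOn F (Icc a b) u') (hint : IntegrableOn F (Icc a b)) :
    F u' * (b - a) ≤ ∫ t in Icc a b, F t := by
  have hconst : ∫ _ in Icc a b, F u' = F u' * (b - a) := by
    rw [setIntegral_const, smul_eq_mul, Real.volume_real_Icc_of_le hab, mul_comm]
  rw [← hconst]
  refine setIntegral_mono_on ?_ hint measurableSet_Icc ?_
  · exact continuousOn_const.integrableOn_Icc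
  · intro x hx
    exact (isMinOn_iff.1 hmin) x hx

/-- KS l.24718–24721 ("We infer `L²_* ≤ ∫_{u₁=u_*−2}^{u_*−1} …`"): on the unit-length interval `[u_* − 2, u_* − 1]` the minimum
value of an integrable `F` is at most its integral. [cite: KlainermanSzeftel2021, §9.4.8 Step 4, TeX l.24718–24721] -/
theorem le_setIntegral_Icc_unit_of_isMinOn {F : ℝ → ℝ} {uStar u' : ℝ}
    (hmin : IsMinOn F (Icc (uStar - 2) (uStar - 1)) u') (hint : IntegrableOn F (Icc (uStar - 2) (uStar - 1))) :
    F u' ≤ ∫ t in Icc (uStar - 2) (uStar - 1), F t := by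
  have h := mul_sub_le_setIntegral_of_isMinOn (F := F) (by linarith) hmin hint
  have e : uStar - 1 - (uStar - 2) = 1 := by ring
  rw [e, mul_one] at h
  exact h

/-- From the choice (9.2.7), integrability of the slice functional on `[u_* − 2, u_* − 1]` and a slab bound
`∫_{[u_*−2,u_*−1]} F ≤ C·(X² + Y²)` one gets `√F(u_*') ≤ √C·(X + Y)` — the shape of KS l.24709–24725 with `X = ℜ`, `Y = 𝔖*`.
[cite: KlainermanSzeftel2021, §9.4.8 Step 4, TeX l.24709–24725] -/
theorem sqrt_le_of_choice946 {F : ℝ → ℝ} {uStar u' C X Y : ℝ} (h946 : Choice946 F uStar u')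
    (hint : IntegrableOn F (Icc (uStar - 2) (uStar - 1)))
    (hslab : ∫ t in Icc (uStar - 2) (uStar - 1), F t ≤ C * (X ^ 2 + Y ^ 2))
    (hC : 0 ≤ C) (hX : 0 ≤ X) (hY : 0 ≤ Y) : Real.sqrt (F u') ≤ Real.sqrt C * (X + Y) := by
  have h1 : F u' ≤ C * (X ^ 2 + Y ^ 2) := (le_setIntegral_Icc_unit_of_isMinOn h946.2 hint).trans hslab
  have h2 : C * (X ^ 2 + Y ^ 2) ≤ C * (X + Y) ^ 2 := by
    apply mul_le_mul_of_nonneg_left _ hC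
    nlinarith [mul_nonneg hX hY]
  calc Real.sqrt (F u') ≤ Real.sqrt (C * (X + Y) ^ 2) := Real.sqrt_le_sqrt (h1.trans h2)
    _ = Real.sqrt C * (X + Y) := by
        rw [Real.sqrt_mul hC, Real.sqrt_sq (add_nonneg hX hY)]

end SliceChoice

namespace Ch9Iteration

open SliceChoice

/-- Registry node KS9.4.8-L7 (l.24709–24725): `L_*(k_large+7) ≲ ℜ_{k_large+7} + 𝔖*_{k_large+7}`, constant independent of `r₀`,
from (9.4.34) (`hLdef`: `L_*(k_large+7) = √F(u_*')`), the choice (9.2.7) (`h946`), integrability of the slice functional on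
`[u_*−2, u_*−1]` (`hint`), the slab comparison "in view of the definition of `|Ř|_{w,k}`, `|Γ̌|_{w,k}`, `ℜ_k`, `𝔖*_k`" (`hslab`, the
geometric hypothesis: coarea in `u`, integrand comparison with (9.4.35), slab `⊂ Mext`) and `^{(ext)}ℜ ≤ ℜ` (`hRext`); the
min-≤-mean step is proved.  Output shape = hypothesis `hL7` of `thm9410_explicit` with `C₅ := √C_co`.
[cite: KlainermanSzeftel2021, §9.4.8 Step 4, TeX l.24709–24725] -/
theorem L7_of_slice (I : Ch9Iteration) {F : ℝ → ℝ} {uStar u' Cco : ℝ}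
    (hLdef : I.L (I.kLarge + 7) = Real.sqrt (F u'))
    (h946 : Choice946 F uStar u')
    (hint : IntegrableOn F (Icc (uStar - 2) (uStar - 1)))
    (hslab : ∫ t in Icc (uStar - 2) (uStar - 1), F t ≤
      Cco * (I.Rext (I.kLarge + 7) ^ 2 + I.Sstar (I.kLarge + 7) ^ 2))
    (hRext : I.Rext (I.kLarge + 7) ≤ I.R (I.kLarge + 7)) (hRext0 : 0 ≤ I.Rext (I.kLarge + 7))
    (hSs : 0 ≤ I.Sstar (I.kLarge + 7)) (hC : 0 ≤ Cco) :
    I.L (I.kLarge + 7) ≤ Real.sqrt Cco * (I.R (I.kLarge + 7) + I.Sstar (I.kLarge + 7)) := by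
  rw [hLdef]
  have h := sqrt_le_of_choice946 h946 hint hslab hC hRext0 hSs
  have hmono : Real.sqrt Cco * (I.Rext (I.kLarge + 7) + I.Sstar (I.kLarge + 7)) ≤
      Real.sqrt Cco * (I.R (I.kLarge + 7) + I.Sstar (I.kLarge + 7)) :=
    mul_le_mul_of_nonneg_left (by linarith) (Real.sqrt_nonneg _)
  exact h.trans hmono

/-- Registry node KS9.4.8-L0 (l.24684–24687): `L_*(k_small−1) ≲ ε₀`.  Typed input `hdec`: a bound `F_{k_small−1}(u_*') ≤ C₀'·ε₀²`
for the level-`(k_small−1)` slice functional at the point `u_*'` chosen in (9.2.7) at the TOP level (so no minimising choice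
is available here, and the bulk norm `^{(ext)}ℜ_{k_small−1}` of (9.4.22) does not control a single slice); `hLdef` is (9.4.34)
at level `k_small−1`.  The implication is the square root.  Output shape = hypothesis `hL0` of `thm9410_explicit`, `C₀ := √C₀'`.
[cite: KlainermanSzeftel2021, §9.4.8 Step 4, TeX l.24684–24687] -/
theorem L0_of_sliceDecay (I : Ch9Iteration) {Fk : ℝ → ℝ} {u' C0' : ℝ}
    (hLdef : I.L (I.kS - 1) = Real.sqrt (Fk u')) (hdec : Fk u' ≤ C0' * I.ε0 ^ 2)
    (hC0 : 0 ≤ C0') (he0 : 0 ≤ I.ε0) : I.L (I.kS - 1) ≤ Real.sqrt C0' * I.ε0 := by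
  rw [hLdef]
  calc Real.sqrt (Fk u') ≤ Real.sqrt (C0' * I.ε0 ^ 2) := Real.sqrt_le_sqrt hdec
    _ = Real.sqrt C0' * I.ε0 := by rw [Real.sqrt_mul hC0, Real.sqrt_sq he0]

/-- Theorem 9.4.10 with the constant `finalConst C₁₃ C₂₁ √C₀' √C_co C₂₂ θ_{k_large+6}`: the certificate
`thm9410_explicit` with its two endpoint inputs `hL0`, `hL7` discharged from the slice data of (9.2.7)/(9.4.34) — the
choice `h946`, integrability `hint`, the slab comparison `hslab`, `^{(ext)}ℜ ≤ ℜ`, and the level-`(k_small−1)` slice bound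
`hdec` — all other hypotheses exactly as in `thm9410_explicit` (uniform Cor. 9.4.21, Lemma 9.4.13, Lemma 9.4.22 with
`0 < θ_{k_large+6} < 1`, `r₀`-largeness `C₂₁ r₀^{−δ_B} √C_co ≤ 1/2`).
[cite: KlainermanSzeftel2021, Theorem 9.4.10 and §9.4.8, TeX l.24053–24064 and l.24606–24747] -/
theorem thm9410_from_slices (I : Ch9Iteration) {C13 C21 C0' Cco C22 : ℝ} {θ : ℕ → ℝ}
    {F Fk : ℝ → ℝ} {uStar u' : ℝ}
    (h13 : I.Lemma9413 C13) (hCor : ∀ Ci : ℝ, 0 ≤ Ci → I.Cor9421 C21 Ci) (h22 : I.Lemma9422 C22 θ)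
    (hθ6 : 0 < θ (I.kLarge + 6)) (hθ6' : θ (I.kLarge + 6) < 1)
    (hL7def : I.L (I.kLarge + 7) = Real.sqrt (F u'))
    (h946 : Choice946 F uStar u')
    (hint : IntegrableOn F (Icc (uStar - 2) (uStar - 1)))
    (hslab : ∫ t in Icc (uStar - 2) (uStar - 1), F t ≤
      Cco * (I.Rext (I.kLarge + 7) ^ 2 + I.Sstar (I.kLarge + 7) ^ 2))
    (hRext : I.Rext (I.kLarge + 7) ≤ I.R (I.kLarge + 7)) (hRext0 : 0 ≤ I.Rext (I.kLarge + 7))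
    (hL0def : I.L (I.kS - 1) = Real.sqrt (Fk u')) (hdec : Fk u' ≤ C0' * I.ε0 ^ 2)
    (hC13 : 0 ≤ C13) (hC21 : 0 ≤ C21) (hC0 : 0 ≤ C0') (hCco : 0 ≤ Cco) (hC22 : 0 ≤ C22)
    (hr0 : 0 < I.r0) (he0 : 0 ≤ I.ε0)
    (hL : ∀ k, I.kS - 1 ≤ k → k ≤ I.kLarge + 7 → 0 ≤ I.L k)
    (hLmono : ∀ k, I.kS - 1 ≤ k → k ≤ I.kLarge + 6 → I.L k ≤ I.L (k + 1))
    (hSstar : ∀ k, I.kS ≤ k → k ≤ I.kLarge + 7 → 0 ≤ I.Sstar k)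
    (hR7 : 0 ≤ I.R (I.kLarge + 7))
    (hlow : ∀ k, k < I.kS - 1 → I.S k + I.R k ≤ I.S (I.kS - 1) + I.R (I.kS - 1))
    (hsmall : C21 * I.r0 ^ (-I.δB) * Real.sqrt Cco ≤ 1 / 2) :
    I.Thm9410 (I.finalConst C13 C21 (Real.sqrt C0') (Real.sqrt Cco) C22 (θ (I.kLarge + 6))) := by
  have hSs7 : 0 ≤ I.Sstar (I.kLarge + 7) := hSstar (I.kLarge + 7) (by unfold kS kSmall; omega) le_rfl
  have hL0 := I.L0_of_sliceDecay hL0def hdec hC0 he0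
  have hL7 := I.L7_of_slice hL7def h946 hint hslab hRext hRext0 hSs7 hCco
  exact I.thm9410_explicit h13 hCor h22 hθ6 hθ6' hL0 hL7 hC13 hC21 (Real.sqrt_nonneg _) (Real.sqrt_nonneg _)
    hC22 hr0 he0 hL hLmono hSstar hR7 hlow hsmall

end Ch9Iteration

/-! ## Journal window: `[J]` (9.2.7) over `[u_* − 5, u_* − 4]` (HAL hal-04280491 p. 606 L21–46), typed over a general window -/

section JournalWindow

namespace SliceChoice

/-- The choice of `u_*'` over a GENERAL window: `u' ∈ [a, b]` realises there the infimum of the slice functional `F`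
(an attained infimum, as both versions of (9.2.7) display it).  [folklore] -/
def ChoiceOn (F : ℝ → ℝ) (a b u' : ℝ) : Prop :=
  u' ∈ Icc a b ∧ IsMinOn F (Icc a b) u'

/-- `[J]` (9.2.7), HAL hal-04280491 p. 606 L21–46, verbatim: "With the notations in (9.2.6), we choose `u_*'` such that we
have `∫_{u=u_*'} |Ř|²_{w,k_large+7} + ∫_{Σ_*∩{u=u_*'}} |Γ̌|²_{w,k_large+7} = inf_{u_*−5 ≤ u₁ ≤ u_*−4} ( ∫_{u=u₁} |Ř|²_{w,k_large+7} +
∫_{Σ_*∩{u=u₁}} |Γ̌|²_{w,k_large+7} )`" — the e-print's window `[u_* − 2, u_* − 1]` (TeX l.23585–23590, `Choice946`) is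
`[u_* − 5, u_* − 4]` in the refereed text (recalled at p. 634 L2–26).  Hypothesis shape (data about the opaque `F`).
[cite: KlainermanSzeftel2023, eq. (9.2.7), HAL hal-04280491 p. 606 L21–46; KlainermanSzeftel2021, eq. (9.2.7), TeX l.23585–23590 (Δ: window)] -/
def Choice927J (F : ℝ → ℝ) (uStar u' : ℝ) : Prop :=
  u' ∈ Icc (uStar - 5) (uStar - 4) ∧ IsMinOn F (Icc (uStar - 5) (uStar - 4)) u'

/-- The e-print choice (9.2.7) is `ChoiceOn` over `[u_* − 2, u_* − 1]`. [cite: KlainermanSzeftel2021, eq. (9.2.7), TeX l.23585–23590] -/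
theorem choice946_iff_choiceOn (F : ℝ → ℝ) (uStar u' : ℝ) :
    Choice946 F uStar u' ↔ ChoiceOn F (uStar - 2) (uStar - 1) u' := Iff.rfl

/-- The journal choice (9.2.7) is `ChoiceOn` over `[u_* − 5, u_* − 4]`. [cite: KlainermanSzeftel2023, eq. (9.2.7), HAL hal-04280491 p. 606 L21–46] -/
theorem choice927J_iff_choiceOn (F : ℝ → ℝ) (uStar u' : ℝ) :
    Choice927J F uStar u' ↔ ChoiceOn F (uStar - 5) (uStar - 4) u' := Iff.rfl

/-- A continuous function on a nonempty compact interval attains its infimum (extreme value theorem): a sufficient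
condition for the choice over `[a, b]`. [folklore] -/
theorem choiceOn_of_continuousOn {F : ℝ → ℝ} {a b : ℝ} (hab : a ≤ b) (hF : ContinuousOn F (Icc a b)) :
    ∃ u', ChoiceOn F a b u' := by
  obtain ⟨u', hu', hmin⟩ := isCompact_Icc.exists_isMinOn (nonempty_Icc.2 hab) hF
  exact ⟨u', hu', hmin⟩

/-- The journal choice is possible for a continuous slice functional. [folklore] -/
theorem choice927J_of_continuousOn {F : ℝ → ℝ} {uStar : ℝ}
    (hF : ContinuousOn F (Icc (uStar - 5) (uStar - 4))) : ∃ u', Choice927J F uStar u' :=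
  choiceOn_of_continuousOn (by linarith) hF

/-- Min ≤ mean on a UNIT-length window: if `u'` minimises an integrable `F` on `[a, b]` with `b − a = 1`, then
`F(u') ≤ ∫_{[a,b]} F` — the step "We infer `L²_*(k_large+7) ≲ ∫_{u₁=a}^{b} ( … ) du₁`" of §9.4.8 Step 4 in either window
(e-print l.24718–24721; `[J]` HAL hal-04280491 p. 634 L27–43). [folklore] -/
theorem le_setIntegral_of_choiceOn_unit {F : ℝ → ℝ} {a b u' : ℝ} (h : ChoiceOn F a b u') (hab : b - a = 1)
    (hint : IntegrableOn F (Icc a b)) : F u' ≤ ∫ t in Icc a b, F t := by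
  have h1 := mul_sub_le_setIntegral_of_isMinOn (F := F) (by linarith) h.2 hint
  rw [hab, mul_one] at h1
  exact h1

/-- From the choice over a unit window, integrability and a slab bound `∫_{[a,b]} F ≤ C·(X² + Y²)`:
`√F(u') ≤ √C·(X + Y)` — the shape of §9.4.8 Step 4 (`[J]` p. 634 L27–47) with `X = ℜ`, `Y = ⋆𝔊`. [folklore] -/
theorem sqrt_le_of_choiceOn {F : ℝ → ℝ} {a b u' C X Y : ℝ} (h : ChoiceOn F a b u') (hab : b - a = 1)
    (hint : IntegrableOn F (Icc a b)) (hslab : ∫ t in Icc a b, F t ≤ C * (X ^ 2 + Y ^ 2))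
    (hC : 0 ≤ C) (hX : 0 ≤ X) (hY : 0 ≤ Y) : Real.sqrt (F u') ≤ Real.sqrt C * (X + Y) := by
  have h1 : F u' ≤ C * (X ^ 2 + Y ^ 2) := (le_setIntegral_of_choiceOn_unit h hab hint).trans hslab
  have h2 : C * (X ^ 2 + Y ^ 2) ≤ C * (X + Y) ^ 2 := by
    apply mul_le_mul_of_nonneg_left _ hC
    nlinarith [mul_nonneg hX hY]
  calc Real.sqrt (F u') ≤ Real.sqrt (C * (X + Y) ^ 2) := Real.sqrt_le_sqrt (h1.trans h2)
    _ = Real.sqrt C * (X + Y) := by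
        rw [Real.sqrt_mul hC, Real.sqrt_sq (add_nonneg hX hY)]

/-- The journal-window instance of `sqrt_le_of_choiceOn`. [cite: KlainermanSzeftel2023, §9.4.8 Step 4, HAL hal-04280491 p. 634 L2–47] -/
theorem sqrt_le_of_choice927J {F : ℝ → ℝ} {uStar u' C X Y : ℝ} (h927 : Choice927J F uStar u')
    (hint : IntegrableOn F (Icc (uStar - 5) (uStar - 4)))
    (hslab : ∫ t in Icc (uStar - 5) (uStar - 4), F t ≤ C * (X ^ 2 + Y ^ 2))
    (hC : 0 ≤ C) (hX : 0 ≤ X) (hY : 0 ≤ Y) : Real.sqrt (F u') ≤ Real.sqrt C * (X + Y) :=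
  sqrt_le_of_choiceOn ((choice927J_iff_choiceOn F uStar u').1 h927) (by ring) hint hslab hC hX hY

end SliceChoice

namespace Ch9Iteration

open SliceChoice

/-- Registry node KS9.4.8-L7 over a GENERAL unit window `[a, b]`: `L_*(k_large+7) ≤ √C_co·(ℜ_{k_large+7} + 𝔖*_{k_large+7})`
from (9.4.34)/`[J]` (9.4.36) (`hLdef`), the choice over `[a, b]` (`hOn`, `hab : b − a = 1`), integrability, the slab comparison
`hslab` and `^{(ext)}ℜ ≤ ℜ` — hypotheses named exactly as in `L7_of_slice`.  [folklore] -/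
theorem L7_of_sliceOn (I : Ch9Iteration) {F : ℝ → ℝ} {a b u' Cco : ℝ}
    (hLdef : I.L (I.kLarge + 7) = Real.sqrt (F u'))
    (hOn : ChoiceOn F a b u') (hab : b - a = 1)
    (hint : IntegrableOn F (Icc a b))
    (hslab : ∫ t in Icc a b, F t ≤ Cco * (I.Rext (I.kLarge + 7) ^ 2 + I.Sstar (I.kLarge + 7) ^ 2))
    (hRext : I.Rext (I.kLarge + 7) ≤ I.R (I.kLarge + 7)) (hRext0 : 0 ≤ I.Rext (I.kLarge + 7))
    (hSs : 0 ≤ I.Sstar (I.kLarge + 7)) (hC : 0 ≤ Cco) :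
    I.L (I.kLarge + 7) ≤ Real.sqrt Cco * (I.R (I.kLarge + 7) + I.Sstar (I.kLarge + 7)) := by
  rw [hLdef]
  have h := sqrt_le_of_choiceOn hOn hab hint hslab hC hRext0 hSs
  have hmono : Real.sqrt Cco * (I.Rext (I.kLarge + 7) + I.Sstar (I.kLarge + 7)) ≤
      Real.sqrt Cco * (I.R (I.kLarge + 7) + I.Sstar (I.kLarge + 7)) :=
    mul_le_mul_of_nonneg_left (by linarith) (Real.sqrt_nonneg _)
  exact h.trans hmono

/-- Registry node KS9.4.8-L7 in the JOURNAL window: `[J]` §9.4.8 Step 4, HAL hal-04280491 p. 634 L2–47 ("recall from (9.2.7) that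
… `= inf_{u_*−5 ≤ u₁ ≤ u_*−4}( … )`.  We infer `L²_*(k_large+7) ≲ ∫_{u₁=u_*−5}^{u_*−4} ( … ) du₁` … we deduce `L_*(k_large+7) ≲
ℜ_{k_large+7} + ⋆𝔊_{k_large+7}` where the constant in `≲` is independent of `r₀`").  Same hypotheses as `L7_of_slice` with the
window moved. [cite: KlainermanSzeftel2023, §9.4.8 Step 4, HAL hal-04280491 p. 634 L2–47] -/
theorem L7_of_sliceJ (I : Ch9Iteration) {F : ℝ → ℝ} {uStar u' Cco : ℝ}
    (hLdef : I.L (I.kLarge + 7) = Real.sqrt (F u'))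
    (h927 : Choice927J F uStar u')
    (hint : IntegrableOn F (Icc (uStar - 5) (uStar - 4)))
    (hslab : ∫ t in Icc (uStar - 5) (uStar - 4), F t ≤
      Cco * (I.Rext (I.kLarge + 7) ^ 2 + I.Sstar (I.kLarge + 7) ^ 2))
    (hRext : I.Rext (I.kLarge + 7) ≤ I.R (I.kLarge + 7)) (hRext0 : 0 ≤ I.Rext (I.kLarge + 7))
    (hSs : 0 ≤ I.Sstar (I.kLarge + 7)) (hC : 0 ≤ Cco) :
    I.L (I.kLarge + 7) ≤ Real.sqrt Cco * (I.R (I.kLarge + 7) + I.Sstar (I.kLarge + 7)) :=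
  I.L7_of_sliceOn hLdef ((choice927J_iff_choiceOn F uStar u').1 h927) (by ring) hint hslab hRext hRext0 hSs hC

/-- Theorem 9.4.10 with the constant `finalConst C₁₃ C₂₁ √C₀' √C_co C₂₂ θ_{k_large+6}` from the JOURNAL slice data: exactly
`thm9410_from_slices` with the choice and the slab taken over `[u_* − 5, u_* − 4]` (`[J]` (9.2.7), p. 606 L21–46; Step 4,
p. 633 L16 – p. 635 L27).  The journal's `ε0` summands in Lemma 9.4.21 (9.4.49) are NOT reflected here (the e-print interpolation
shape `Lemma9422` is kept, as in `thm9410_explicit`; the audit cell records that delta separately).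
[cite: KlainermanSzeftel2023, Theorem 9.4.10 and §9.4.8, HAL hal-04280491 p. 615 L75 – p. 616 L4 and p. 629 L35 – p. 635 L27; KlainermanSzeftel2021, Theorem 9.4.10 and §9.4.8, TeX l.24053–24064 and l.24606–24747] -/
theorem thm9410_from_slicesJ (I : Ch9Iteration) {C13 C21 C0' Cco C22 : ℝ} {θ : ℕ → ℝ}
    {F Fk : ℝ → ℝ} {uStar u' : ℝ}
    (h13 : I.Lemma9413 C13) (hCor : ∀ Ci : ℝ, 0 ≤ Ci → I.Cor9421 C21 Ci) (h22 : I.Lemma9422 C22 θ)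
    (hθ6 : 0 < θ (I.kLarge + 6)) (hθ6' : θ (I.kLarge + 6) < 1)
    (hL7def : I.L (I.kLarge + 7) = Real.sqrt (F u'))
    (h927 : Choice927J F uStar u')
    (hint : IntegrableOn F (Icc (uStar - 5) (uStar - 4)))
    (hslab : ∫ t in Icc (uStar - 5) (uStar - 4), F t ≤
      Cco * (I.Rext (I.kLarge + 7) ^ 2 + I.Sstar (I.kLarge + 7) ^ 2))
    (hRext : I.Rext (I.kLarge + 7) ≤ I.R (I.kLarge + 7)) (hRext0 : 0 ≤ I.Rext (I.kLarge + 7))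
    (hL0def : I.L (I.kS - 1) = Real.sqrt (Fk u')) (hdec : Fk u' ≤ C0' * I.ε0 ^ 2)
    (hC13 : 0 ≤ C13) (hC21 : 0 ≤ C21) (hC0 : 0 ≤ C0') (hCco : 0 ≤ Cco) (hC22 : 0 ≤ C22)
    (hr0 : 0 < I.r0) (he0 : 0 ≤ I.ε0)
    (hL : ∀ k, I.kS - 1 ≤ k → k ≤ I.kLarge + 7 → 0 ≤ I.L k)
    (hLmono : ∀ k, I.kS - 1 ≤ k → k ≤ I.kLarge + 6 → I.L k ≤ I.L (k + 1))
    (hSstar : ∀ k, I.kS ≤ k → k ≤ I.kLarge + 7 → 0 ≤ I.Sstar k)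
    (hR7 : 0 ≤ I.R (I.kLarge + 7))
    (hlow : ∀ k, k < I.kS - 1 → I.S k + I.R k ≤ I.S (I.kS - 1) + I.R (I.kS - 1))
    (hsmall : C21 * I.r0 ^ (-I.δB) * Real.sqrt Cco ≤ 1 / 2) :
    I.Thm9410 (I.finalConst C13 C21 (Real.sqrt C0') (Real.sqrt Cco) C22 (θ (I.kLarge + 6))) := by
  have hSs7 : 0 ≤ I.Sstar (I.kLarge + 7) := hSstar (I.kLarge + 7) (by unfold kS kSmall; omega) le_rfl
  have hL0 := I.L0_of_sliceDecay hL0def hdec hC0 he0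
  have hL7 := I.L7_of_sliceJ hL7def h927 hint hslab hRext hRext0 hSs7 hCco
  exact I.thm9410_explicit h13 hCor h22 hθ6 hθ6' hL0 hL7 hC13 hC21 (Real.sqrt_nonneg _) (Real.sqrt_nonneg _)
    hC22 hr0 he0 hL hLmono hSstar hR7 hlow hsmall

end Ch9Iteration

end JournalWindow

end Literature.Geometry.Lorentzian.KlainermanSzeftel2021
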